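import Summits.FinalStateConjecture.FinalStateConjecture.Theorems.SettledCapture.Negative.TypedNormalForm
import Summits.FinalStateConjecture.FinalStateConjecture.Theorems.BartnikGapSettlingCaptureSoundDefs
import Summits.FinalStateConjecture.FinalStateConjecture.Theorems.BartnikGapSettlingCaptureStubMinkowskiSoundLeaf
import HarnessLib

/-!
# The RE-TYPED crux `SettledCapture` over SOUND leaves — candidate item text for the planners
# (crux stmt-FinalStateConjecture-17328, route `BartnikGapSettling`; line-lead seat c1, 2026-08-17)

Negative-lane helper next to `Negative/TypedNormalForm.lean` (p146299); no Theses decl is asserted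
positively.  The crux `Theses.BartnikGapSettling.SettledCapture` AS TYPED
carries the idle 40-binder leaf block of `CauchyDevelopment.IsNearKerrLeaf` (THE DODGE:
`Negative/TypedNormalForm.lean` p146299, `Lines/birth-dead.md`, item notes 07:21Z / 09:31Z), so it is
the non-generic T2 settling statement.  The repair recorded three times on the item is: keep the T2
conclusion verbatim, re-type the leaf block over `CauchyDevelopment.IsSoundNearKerrLeaf` — exactly as
the sibling crux `Capture` was given `SoundCapture` (`BartnikGapSettlingCaptureSoundDefs.lean`, p125313).
This file writes that text down ONCE as a kernel-checked closed `Prop`, `SoundSettledCapture`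
(= `SoundCapture`'s hypotheses verbatim + `SettledCapture`'s conclusion verbatim), and certifies:

* `soundSettledCapture_of_settledCapture_body` — the typed crux (its body verbatim, Theses-free)
  implies the re-typed one: re-typing WEAKENS the item (sound leaves are typed leaves);
* `soundCapture_of_soundSettledCapture` — the re-typed T2 crux refines the re-typed Capture
  (drop the rays and orientation clauses), so every `SoundCapture` dead-line / sector lemma
  (`soundCapture_iff_forall_sector`, p125700) is inherited;
* the Minkowski column: `soundLeafHyp_minkowski` (the SOUND hypothesis block holds at the certified
  Minkowski development, `N₀ = 0`, by `Capture.stub_minkowskiSoundLeaf` p125739 — honest hyperboloids,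
  not dodge sheets), `soundSettledCapture_body_minkowski` (the re-typed body holds there, conclusion by
  `t2Conclusion_minkowski`), `allSoundHyps_minkowski_of_mghdExists` (admissible ∧ maximal ∧ complete 𝓘⁺ ∧
  sound leaves ∧ T2 conclusion jointly at ONE development, modulo the route's own crux `MGHDExists`):
  the re-typed item is consistent, non-vacuous, and true at the trivial datum for the right reason.

Planner usage: restate stmt-FinalStateConjecture-17328 with signature = the body of
`SoundSettledCapture` below (one physical line, `open Literature.Geometry.Lorentzian in` prefix as in
the current decl); the leaf-free lemmas already landed for the item (`stub_visibleRaysStay` p149576,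
`exit_of_weightedConcave` p153671) serve the re-typed item unchanged.

References: DHRT arXiv:2104.08222, §1 (chart/deviation vocabulary); O'Neill 1983, Ch. 14, p. 413
(achronal sets); Choquet-Bruhat–Geroch, CMP 14 (1969), Thm. 3; Christodoulou–Klainerman 1993, Thm. 1.0.2.
-/

set_option linter.dupNamespace false

noncomputable section

open Set
open scoped Manifold ContDiff ENNReal
open Literature.Geometry.Lorentzian

namespace Summit.FinalStateConjecture.FinalStateConjecture.Theorems.SettledCapture.Retype

open Summit.FinalStateConjecture.FinalStateConjecture.Theorems
open Summit.FinalStateConjecture.FinalStateConjecture.Theorems.SettledCapture.Negative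
open Summit.FinalStateConjecture.FinalStateConjecture.Theorems.BartnikGapSettling

/-- **The crux `SettledCapture` RE-TYPED over sound leaves** (candidate item text): the hypotheses of
`Capture.SoundCapture` verbatim (leaf block = `𝒟.toCauchyDevelopment.IsSoundNearKerrLeaf k ε N M a S`),
the conclusion of `Theses.BartnikGapSettling.SettledCapture` verbatim (sub-extremal labels,
`O = exteriorOf`, `RaysStayInClosure`, `HasExhaustiveCharts`, `IsFutureOriented`). An OPEN statement
(crux-grade), recorded as text, not as a fact. [conjecture] [folklore] -/
def SoundSettledCapture : Prop :=
  ∀ (X : Type) [TopologicalSpace X] [ChartedSpace E3 X] [IsManifold (𝓡 3) ((⊤ : ℕ∞) : WithTop ℕ∞) X] [T2Space X] [SecondCountableTopology X] [ConnectedSpace X], ∀ D ∈ admissibleVacuumData X, ∀ 𝒟 : VacuumCauchyDevelopment D, 𝒟.IsMaximal → Summit.FinalStateConjecture.HasCompleteNullInfinity 𝒟.toCauchyDevelopment → (∃ (N₀ : ℕ) (m₀ χ : ℝ) (k₁ : ℕ) (ε₁ : ENNReal), 0 < m₀ ∧ χ < 1 ∧ 0 < ε₁ ∧ ∀ (k :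 ℕ) (ε : ENNReal), 0 < ε → ∀ K : Set 𝒟.carrier, IsCompact K → ∃ (N : ℕ) (M a : Fin N → ℝ) (S : Set 𝒟.carrier), N ≤ N₀ ∧ (∀ i, m₀ ≤ M i ∧ M i ≤ m₀⁻¹) ∧ Disjoint S (𝒟.metric.causalPast 𝒟.timeOrientation K) ∧ 𝒟.toCauchyDevelopment.IsSoundNearKerrLeaf k ε N M a S ∧ (k₁ ≤ k → ε ≤ ε₁ → ∀ i, |a i| ≤ χ * M i)) → (∃ (O : Set 𝒟.carrier) (d : FinalStateDecomposition 𝒟.toSpacetime O 2), (∀ i, Kerr.IsSubextremal (d.mass i) (d.spin i)) ∧ O = Summit.FinalStateConjecture.exteriorOf 𝒟.toCauchyDevelopment d.charted ∧ Summit.FinalStateConjecture.RaysStayInClosure 𝒟.toCauchyDevelopment O ∧ Summit.FinalStateConjecture.HasExhaustiveCharts d ∧ Summit.FinalStateConjecture.IsFutureOriented d)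

/-- **Re-typing weakens the crux**: the body of `Theses.BartnikGapSettling.SettledCapture` VERBATIM
(so that it `δ`-unfolds to the route decl; Theses-free) implies `SoundSettledCapture` — a sound leaf is
a typed leaf with the same labels and set (`IsSoundNearKerrLeaf.isNearKerrLeaf`). [folklore] -/
theorem soundSettledCapture_of_settledCapture_body :
    (∀ (X : Type) [TopologicalSpace X] [ChartedSpace E3 X] [IsManifold (𝓡 3) ((⊤ : ℕ∞) : WithTop ℕ∞) X] [T2Space X] [SecondCountableTopology X] [ConnectedSpace X], ∀ D ∈ admissibleVacuumData X, ∀ 𝒟 : VacuumCauchyDevelopment D, 𝒟.IsMaximal → Summit.FinalStateConjecture.HasCompleteNullInfinity 𝒟.toCauchyDevelopment → (∃ (N₀ : ℕ) (m₀ χ : ℝ) (k₁ : ℕ) (ε₁ : ENNReal), 0 < m₀ ∧ χ < 1 ∧ 0 < ε₁ ∧ ∀ (k : ℕ) (ε : ENNReal), 0 < ε → ∀ K : Set 𝒟.carrier, IsCompact K → ∃ (N : ℕ) (M a : Fin N → ℝ) (S : Set 𝒟.carrier), N ≤ N₀ ∧ (∀ i, m₀ ≤ M i ∧ M i ≤ m₀⁻¹)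 ∧ Disjoint S (𝒟.metric.causalPast 𝒟.timeOrientation K) ∧ (∃ (R ρ : Fin N → ℝ) (mo : Fin N → lorentzGroup × E4) (r : Fin N → E4 → ℝ) (B : Fin N → ModelBackground) (U₀ : TopologicalSpace.Opens E4) (B₀ : ModelBackground) (Ψ : ∀ i, (B i).domain → 𝒟.carrier) (Ψ₀ : B₀.domain → 𝒟.carrier) (L W : ∀ i, Set (B i).domain) (L₀ W₀ : Set B₀.domain), (∀ i, r i = fun x => Kerr.radius (a i) (poincareInv (mo i).1 (mo i).2 x)) ∧ (∀ i, B i = (⟨⟨poincareInv (mo i).1 (mo i).2 ⁻¹' (Kerr.region (a i) (M i) : Set E4), (Kerr.region (a i) (M i)).isOpen.preimage (continuous_poincareInv (mo i).1 (mo i).2)⟩, boostedKerrBilin (mo i).1 (mo i).2 (M i) (a i), fun x => poincareInv (mo i).1 (mo i).2 x 0, r i⟩ : ModelBackground)) ∧ B₀ = (⟨U₀, fun _ => Minkowski.bilin, fun x => x 0 - Real.sqrt (1 + E4.spatialNorm x ^ 2), E4.spatialNorm⟩ : ModelBackground) ∧ (∀ i, L i = {x | -1 < (B i).time x.1 ∧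 (B i).time x.1 < 1 ∧ (B i).radius x.1 < R i + 1} ∧ W i = {x | 0 < (B i).time x.1 ∧ (B i).time x.1 < 1 ∧ (B i).radius x.1 ≤ R i}) ∧ L₀ = {x | -1 < B₀.time x.1 ∧ B₀.time x.1 < 1} ∧ W₀ = {x | 0 < B₀.time x.1 ∧ B₀.time x.1 < 1} ∧ (∀ i, 0 < M i ∧ |a i| ≤ M i ∧ 0 < ρ i ∧ ρ i < R i) ∧ {x : E4 | -1 < x 0 - Real.sqrt (1 + E4.spatialNorm x ^ 2) ∧ ∀ i, ρ i < r i x} ⊆ (U₀ : Set E4) ∧ (∀ i, ContMDiffOn 𝓘(ℝ, E4) (𝓡 4) ((⊤ : ℕ∞) : WithTop ℕ∞) (Ψ i) (L i) ∧ Topology.IsOpenEmbedding ((L i).restrict (Ψ i)) ∧ Ψ i '' L i ⊆ 𝒟.metric.causalFuture 𝒟.timeOrientation (Set.range 𝒟.embed)) ∧ ContMDiffOn 𝓘(ℝ, E4) (𝓡 4) ((⊤ : ℕ∞) : WithTop ℕ∞) Ψ₀ L₀ ∧ Topology.IsOpenEmbedding (L₀.restrict Ψ₀) ∧ Ψ₀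 '' L₀ ⊆ 𝒟.metric.causalFuture 𝒟.timeOrientation (Set.range 𝒟.embed) ∧ (∀ i, 𝒟.toSpacetime.truncDeviationCk (B i) (Ψ i) k (R i) 0 ≤ ε) ∧ 𝒟.toSpacetime.deviationCk B₀ Ψ₀ k 0 ≤ ε ∧ Pairwise (Function.onFun Disjoint fun i => Ψ i '' {x | x ∈ L i ∧ (B i).radius x.1 ≤ R i}) ∧ (∀ i, Ψ i '' {x | (B i).time x.1 = 0 ∧ ρ i < (B i).radius x.1 ∧ (B i).radius x.1 ≤ R i} ⊆ Ψ₀ '' L₀) ∧ (∀ i, Ψ₀ '' {x | B₀.time x.1 = 0 ∧ ρ i < r i x.1 ∧ r i x.1 < R i} ⊆ Ψ i '' L i) ∧ S = Ψ₀ '' B₀.timeSlab 0 ∪ ⋃ i, Ψ i '' (B i).truncTimeSlab (R i) 0 ∧ Ψ₀ '' W₀ ∪ ⋃ i, Ψ i '' W i ⊆ 𝒟.metric.chronologicalFuture 𝒟.timeOrientation S ∧ Summit.FinalStateConjecture.exteriorOf 𝒟.toCauchyDevelopment (Ψ₀ '' W₀ ∪ ⋃ i, Ψ i '' W i) \ (Ψ₀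 '' W₀ ∪ ⋃ i, Ψ i '' W i) ⊆ 𝒟.metric.causalPast 𝒟.timeOrientation S) ∧ (k₁ ≤ k → ε ≤ ε₁ → ∀ i, |a i| ≤ χ * M i)) → (∃ (O : Set 𝒟.carrier) (d : FinalStateDecomposition 𝒟.toSpacetime O 2), (∀ i, Kerr.IsSubextremal (d.mass i) (d.spin i)) ∧ O = Summit.FinalStateConjecture.exteriorOf 𝒟.toCauchyDevelopment d.charted ∧ Summit.FinalStateConjecture.RaysStayInClosure 𝒟.toCauchyDevelopment O ∧ Summit.FinalStateConjecture.HasExhaustiveCharts d ∧ Summit.FinalStateConjecture.IsFutureOriented d)) →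
      SoundSettledCapture := by
  intro hC X _ _ _ _ _ _ D hD 𝒟 hmax hCNI hyp
  obtain ⟨N₀, m₀, χ, k₁, ε₁, hm₀, hχ, hε₁, H⟩ := hyp
  refine hC X D hD 𝒟 hmax hCNI ⟨N₀, m₀, χ, k₁, ε₁, hm₀, hχ, hε₁, fun k ε hε K hK ↦ ?_⟩
  obtain ⟨N, M, a, S, hN, hwin, hdisj, hleaf, hmargin⟩ := H k ε hε K hK
  exact ⟨N, M, a, S, hN, hwin, hdisj, hleaf.isNearKerrLeaf, hmargin⟩

/-- The same against the route decl by name (this evidence file may import the Theses module; a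
landed closer would use the body form above). [folklore] -/
theorem soundSettledCapture_of_settledCapture
    (h : Theses.BartnikGapSettling.SettledCapture) : SoundSettledCapture :=
  soundSettledCapture_of_settledCapture_body h

/-- **The T2 re-type refines the Capture re-type**: drop the rays and orientation clauses.
[folklore] -/
theorem soundCapture_of_soundSettledCapture (h : SoundSettledCapture) : Capture.SoundCapture := by
  intro X _ _ _ _ _ _ D hD 𝒟 hmax hCNI hyp
  obtain ⟨O, d, hsub, hO, -, hex, -⟩ := h X D hD 𝒟 hmax hCNI hyp
  exact ⟨O, d, hsub, hO, hex⟩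

/-! ### The Minkowski column of the re-typed crux -/

/-- The SOUND leaf hypothesis block of `SoundSettledCapture`, for one development. [folklore] -/
def SoundLeafHyp {X : Type} [TopologicalSpace X] [ChartedSpace E3 X] [IsManifold (𝓡 3) ∞ X]
    [ConnectedSpace X] {D : InitialDataSet (𝓡 3) X} (𝒟 : VacuumCauchyDevelopment D) : Prop :=
  ∃ (N₀ : ℕ) (m₀ χ : ℝ) (k₁ : ℕ) (ε₁ : ℝ≥0∞), 0 < m₀ ∧ χ < 1 ∧ 0 < ε₁ ∧
    ∀ (k : ℕ) (ε : ℝ≥0∞), 0 < ε → ∀ K : Set 𝒟.carrier, IsCompact K →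
      ∃ (N : ℕ) (M a : Fin N → ℝ) (S : Set 𝒟.carrier), N ≤ N₀ ∧ (∀ i, m₀ ≤ M i ∧ M i ≤ m₀⁻¹) ∧
        Disjoint S (𝒟.metric.causalPast 𝒟.timeOrientation K) ∧
        𝒟.toCauchyDevelopment.IsSoundNearKerrLeaf k ε N M a S ∧
        (k₁ ≤ k → ε ≤ ε₁ → ∀ i, |a i| ≤ χ * M i)

/-- Sound normal form, by `Iff.rfl`. [folklore] -/
theorem soundSettledCapture_iff :
    SoundSettledCapture ↔
      ∀ (X : Type) [TopologicalSpace X] [ChartedSpace E3 X] [IsManifold (𝓡 3) ∞ X] [T2Space X]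
        [SecondCountableTopology X] [ConnectedSpace X], ∀ D ∈ admissibleVacuumData X,
        ∀ 𝒟 : VacuumCauchyDevelopment D, 𝒟.IsMaximal →
          Summit.FinalStateConjecture.HasCompleteNullInfinity 𝒟.toCauchyDevelopment →
            SoundLeafHyp 𝒟 → T2Conclusion 𝒟 :=
  Iff.rfl

/-- The SOUND leaf hypothesis holds at the Minkowski development (`N₀ = 0`, `m₀ = 1`, `χ = 0`,
`k₁ = 0`, `ε₁ = ⊤`; leaves = the honest unit hyperboloids of `Capture.stub_minkowskiSoundLeaf`, NOT
dodge sheets). [cite: ONeillSemiRiemannian1983, Ch. 14, p. 413] -/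
theorem soundLeafHyp_minkowski : SoundLeafHyp Minkowski.vacuumCauchyDevelopment := by
  refine ⟨0, 1, 0, 0, ⊤, one_pos, zero_lt_one, ENNReal.zero_lt_top, fun k ε _ K hK => ?_⟩
  obtain ⟨S, hdisj, hleaf⟩ := Capture.stub_minkowskiSoundLeaf k ε K hK
  exact ⟨0, ![], ![], S, le_rfl, fun i => i.elim0, hdisj, hleaf, fun _ _ i => i.elim0⟩

/-- The re-typed body holds at the Minkowski development (its conclusion is true there).
[cite: ChristodoulouKlainerman1993, Thm. 1.0.2] -/
theorem soundSettledCapture_body_minkowski :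
    Minkowski.vacuumCauchyDevelopment.IsMaximal →
      Summit.FinalStateConjecture.HasCompleteNullInfinity
          Minkowski.vacuumCauchyDevelopment.toCauchyDevelopment →
        SoundLeafHyp Minkowski.vacuumCauchyDevelopment →
          T2Conclusion Minkowski.vacuumCauchyDevelopment :=
  fun _ _ _ => t2Conclusion_minkowski

/-- Anti-vacuity of the re-typed crux modulo the route's crux `MGHDExists`: admissible datum,
`IsMaximal`, complete `𝓘⁺`, the SOUND leaf hypothesis and the T2 conclusion hold together at the
Minkowski development. [cite: ChoquetBruhatGeroch1969CMP, Thm. 3] -/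
theorem allSoundHyps_minkowski_of_mghdExists (h : Theses.BartnikGapSettling.MGHDExists) :
    trivialData ∈ admissibleVacuumData Minkowski.slice ∧
      Minkowski.vacuumCauchyDevelopment.IsMaximal ∧
        Summit.FinalStateConjecture.HasCompleteNullInfinity
            Minkowski.vacuumCauchyDevelopment.toCauchyDevelopment ∧
          SoundLeafHyp Minkowski.vacuumCauchyDevelopment ∧
            T2Conclusion Minkowski.vacuumCauchyDevelopment := by
  obtain ⟨h₁, h₂, h₃, -, h₅⟩ := allHyps_minkowski_of_mghdExists h
  exact ⟨h₁, h₂, h₃, soundLeafHyp_minkowski, h₅⟩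

end Summit.FinalStateConjecture.FinalStateConjecture.Theorems.SettledCapture.Retype

end
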